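import Literature.Computability.Cryptography.OneWayFunctions
import Mathlib.Data.Nat.Log
import HarnessLib

/-!
# Liu–Pass, Lemma 5.4 (step 1): every function is regular on a dense set of inputs

First piece of the decomposition of the named fact `condEPPRG_of_OWFExist` (Liu–Pass, FOCS 2020,
Thm 5.5: cond EP-PRGs from one-way functions) announced in `LiuPassPadding.lean`. Thm 5.5 is proved
in print from Lemma 5.3 (a cond EP-PRG from a *regular* `S`-one-way function, Goldreich–Levin plus
hashing — to stay a named fact) and Lemma 5.4 (every one-way function is a regular `S`-one-way
function on sets `S_n` of density `≥ 1/n`). This file proves the combinatorial core of Lemma 5.4,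
its Claim 3, for an *arbitrary* function `f`:

* `preimCard f n x` — the number of length-`n` inputs colliding with `x` under `f`;
* `regCls f n r` — the `r`-th regularity class `{x ∈ {0,1}ⁿ : 2^{r-1} ≤ preimCard f n x ≤ 2ʳ}`;
* `mem_regCls_clog` — every `x` lies in the class `r = max 1 ⌈log₂ (preimCard f n x)⌉ ∈ [1, n]`;
* `exists_dense_regCls` (**Claim 3**) — for `n ≥ 1` some class `r ∈ [1, n]` has
  `n · |regCls f n r| ≥ 2ⁿ` (density `≥ 1/n`), by averaging over the `n` classes.

* `lpRegIdx f n`, `lpRegSet f n` — Liu–Pass's choice `r(n)` and `S_n` (a dense class, by choice),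
  with `card_lpRegSet` (density `2ⁿ ≤ n · |S_n|` for `n ≥ 1`) and `preimCard_of_mem_lpRegSet`
  (regularity `2^{r(n)-1} ≤ |f⁻¹(f x) ∩ {0,1}ⁿ| ≤ 2^{r(n)}` on `S_n`).

The one-wayness half of Lemma 5.4 (an inverter on `S_n` is an inverter on `{0,1}ⁿ` up to the
factor `n`) and the assembly of Thm 5.5 are left to the sequel.

## References

* Y. Liu, R. Pass, *On one-way functions and Kolmogorov complexity*, FOCS 2020
  (arXiv:2009.11514), §5.3, Lemma 5.4 and its Claim 3; Def. of regular (`S`-)one-way functions.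
* O. Goldreich, *Foundations of Cryptography I*, CUP 2001, §3.5 (regular one-way functions).
-/

namespace Literature.Computability.Cryptography

open Finset

/-- The number of length-`n` inputs `x'` with `f x' = f x` (the size of the preimage class of
`f x` inside `{0,1}ⁿ`). [Y. Liu, R. Pass, FOCS 2020, Def. (regular), §5.3] [cite: LiuPassFOCS2020, Lemma 5.4] -/
noncomputable def preimCard (f : List Bool → List Bool) (n : ℕ) (x : List Bool) : ℕ :=
  open scoped Classical in
  (univ.filter fun x' : List.Vector Bool n => f x'.toList = f x).card

/-- The `r`-th regularity class of `f` at length `n`: inputs whose preimage class has size in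
`[2^{r-1}, 2ʳ]`. [Y. Liu, R. Pass, FOCS 2020, proof of Lemma 5.4 (the sets `S_n`)] [cite: LiuPassFOCS2020, Lemma 5.4] -/
noncomputable def regCls (f : List Bool → List Bool) (n r : ℕ) : Finset (List.Vector Bool n) :=
  univ.filter fun x => 2 ^ (r - 1) ≤ preimCard f n x.toList ∧ preimCard f n x.toList ≤ 2 ^ r

/-- An input collides with itself: `1 ≤ preimCard f n x` for `x ∈ {0,1}ⁿ`. [folklore] -/
theorem one_le_preimCard (f : List Bool → List Bool) {n : ℕ} (x : List.Vector Bool n) :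
    1 ≤ preimCard f n x.toList := by
  classical
  unfold preimCard
  exact card_pos.2 ⟨x, by simp⟩

/-- `preimCard f n x ≤ 2ⁿ`. [folklore] -/
theorem preimCard_le (f : List Bool → List Bool) (n : ℕ) (x : List Bool) : preimCard f n x ≤ 2 ^ n := by
  classical
  unfold preimCard
  exact (card_filter_le _ _).trans (by rw [card_univ, card_vector, Fintype.card_bool])

/-- **Every input lies in a regularity class with index in `[1, n]`**, namely
`r = max 1 ⌈log₂ (preimCard f n x)⌉`. [Y. Liu, R. Pass, FOCS 2020, proof of Claim 3] [cite: LiuPassFOCS2020, Lemma 5.4] -/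
theorem mem_regCls_clog (f : List Bool → List Bool) {n : ℕ} (x : List.Vector Bool n) :
    x ∈ regCls f n (max 1 (Nat.clog 2 (preimCard f n x.toList))) ∧
      1 ≤ max 1 (Nat.clog 2 (preimCard f n x.toList)) ∧ max 1 (Nat.clog 2 (preimCard f n x.toList)) ≤ max 1 n := by
  set p := preimCard f n x.toList with hp
  have h1 : 1 ≤ p := one_le_preimCard f x
  have h2 : p ≤ 2 ^ n := preimCard_le f n x.toList
  have hclog : Nat.clog 2 p ≤ n := Nat.clog_le_of_le_pow h2
  refine ⟨?_, le_max_left _ _, max_le_max le_rfl hclog⟩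
  simp only [regCls, mem_filter, mem_univ, true_and, ← hp]
  rcases Nat.lt_or_ge 1 p with hlt | hle
  · -- `p ≥ 2`: `2^{clog p - 1} < p ≤ 2^{clog p}` and `clog p ≥ 1`
    have hc1 : 1 ≤ Nat.clog 2 p := Nat.clog_pos one_lt_two hlt
    rw [max_eq_right hc1]
    exact ⟨(Nat.pow_pred_clog_lt_self one_lt_two hlt).le, Nat.le_pow_clog one_lt_two p⟩
  · -- `p = 1`: the class `r = 1`
    have hp1 : p = 1 := le_antisymm hle h1
    rw [hp1]
    simp [Nat.clog]

/-- **Claim 3 of Liu–Pass's Lemma 5.4**: for every `f` and every `n ≥ 1` there is an index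
`r ∈ [1, n]` whose regularity class has density at least `1/n`: `2ⁿ ≤ n · |regCls f n r|`.
[Y. Liu, R. Pass, FOCS 2020, Lemma 5.4, Claim 3 ("by an averaging argument")] [cite: LiuPassFOCS2020, Lemma 5.4] -/
theorem exists_dense_regCls (f : List Bool → List Bool) {n : ℕ} (hn : 1 ≤ n) :
    ∃ r, 1 ≤ r ∧ r ≤ n ∧ 2 ^ n ≤ n * (regCls f n r).card := by
  classical
  -- the classes with index in `[1, n]` cover `{0,1}ⁿ`
  have hcover : (univ : Finset (List.Vector Bool n)) ⊆ (Icc 1 n).biUnion fun r => regCls f n r := by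
    intro x _
    obtain ⟨hx, h1, hle⟩ := mem_regCls_clog f x
    rw [max_eq_right hn] at hle
    exact mem_biUnion.2 ⟨_, mem_Icc.2 ⟨h1, hle⟩, hx⟩
  have hsum : 2 ^ n ≤ ∑ r ∈ Icc 1 n, (regCls f n r).card := by
    calc 2 ^ n = (univ : Finset (List.Vector Bool n)).card := by rw [card_univ, card_vector, Fintype.card_bool]
      _ ≤ ((Icc 1 n).biUnion fun r => regCls f n r).card := card_le_card hcover
      _ ≤ ∑ r ∈ Icc 1 n, (regCls f n r).card := card_biUnion_le
  -- averaging over the `n` indices: if every class were sparse, the sum would be `< 2ⁿ`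
  by_contra hno
  push Not at hno
  have hstrict : ∑ r ∈ Icc 1 n, n * (regCls f n r).card < ∑ r ∈ Icc 1 n, 2 ^ n :=
    sum_lt_sum_of_nonempty ⟨1, mem_Icc.2 ⟨le_rfl, hn⟩⟩ fun r hr => by
      obtain ⟨hr1, hr2⟩ := mem_Icc.1 hr
      exact hno r hr1 hr2
  rw [← mul_sum, sum_const, Nat.card_Icc, smul_eq_mul, Nat.add_sub_cancel] at hstrict
  have := Nat.mul_le_mul_left n hsum
  omega

/-- Liu–Pass's regularity index `r(n)` of `f`: an index of a dense regularity class (Claim 3),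
`0` at `n = 0`. [Y. Liu, R. Pass, FOCS 2020, proof of Lemma 5.4 ("let `r(n) = r_n`")] [cite: LiuPassFOCS2020, Lemma 5.4] -/
noncomputable def lpRegIdx (f : List Bool → List Bool) (n : ℕ) : ℕ :=
  if hn : 1 ≤ n then Classical.choose (exists_dense_regCls f hn) else 0

/-- Liu–Pass's dense regular domain `S_n = {x ∈ {0,1}ⁿ : 2^{r(n)-1} ≤ |f⁻¹(f x)| ≤ 2^{r(n)}}`.
[Y. Liu, R. Pass, FOCS 2020, proof of Lemma 5.4] [cite: LiuPassFOCS2020, Lemma 5.4] -/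
noncomputable def lpRegSet (f : List Bool → List Bool) (n : ℕ) : Finset (List.Vector Bool n) :=
  regCls f n (lpRegIdx f n)

/-- The regularity index lies in `[1, n]` for `n ≥ 1`. [cite: LiuPassFOCS2020, Lemma 5.4] -/
theorem lpRegIdx_mem {f : List Bool → List Bool} {n : ℕ} (hn : 1 ≤ n) : 1 ≤ lpRegIdx f n ∧ lpRegIdx f n ≤ n := by
  unfold lpRegIdx; rw [dif_pos hn]
  obtain ⟨h1, h2, -⟩ := Classical.choose_spec (exists_dense_regCls f hn)
  exact ⟨h1, h2⟩

/-- **Density of `S_n`** (Lemma 5.4: `|S_n| ≥ 2ⁿ/n`): `2ⁿ ≤ n · |S_n|` for `n ≥ 1`.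
[Y. Liu, R. Pass, FOCS 2020, Lemma 5.4] [cite: LiuPassFOCS2020, Lemma 5.4] -/
theorem card_lpRegSet (f : List Bool → List Bool) {n : ℕ} (hn : 1 ≤ n) : 2 ^ n ≤ n * (lpRegSet f n).card := by
  unfold lpRegSet lpRegIdx; rw [dif_pos hn]
  exact (Classical.choose_spec (exists_dense_regCls f hn)).2.2

/-- **Regularity of `f` on `S_n`**: every `x ∈ S_n` has `2^{r(n)-1} ≤ |f⁻¹(f x) ∩ {0,1}ⁿ| ≤ 2^{r(n)}`.
[Y. Liu, R. Pass, FOCS 2020, Lemma 5.4 ("regularity of `f` when the input domain is restricted to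
`S` follows directly")] [cite: LiuPassFOCS2020, Lemma 5.4] -/
theorem preimCard_of_mem_lpRegSet {f : List Bool → List Bool} {n : ℕ} {x : List.Vector Bool n}
    (hx : x ∈ lpRegSet f n) :
    2 ^ (lpRegIdx f n - 1) ≤ preimCard f n x.toList ∧ preimCard f n x.toList ≤ 2 ^ lpRegIdx f n := by
  simpa [lpRegSet, regCls] using hx

end Literature.Computability.Cryptography
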